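import Literature.MathematicalPhysics.QuantumFieldTheory.Balaban1983to89.B15Ineq196Proof
import Literature.MathematicalPhysics.QuantumFieldTheory.Balaban1983to89.B15Claim179Flow

/-!
# `Balaban1983to89.B15Claim189Cases` — [Balaban1989LargeFieldI] p. 200: *"Now we have to analyze this bound on all the
# domains in the definition (1.24)"* … *"Thus we have proved that the configuration U″_{k,Z} satisfies all the conditions
# in the definition (1.24), hence χ″_k = 1, and the equality (1.89) is proved."* — the closing case analysis of the proof
# of (1.89), PROVED as located arithmetic over the typed leaves (the exponential over the shells along any [III] flow)

statement-level skeleton of published theorems with citation tags; proofs where landed; nothing here is a claim about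
the Yang–Mills mass gap.

CITATION HEADER (lean-in-tree rule 2026-08-18).  T. Bałaban, *Large field renormalization. I. The basic step of the 𝐑
operation*, Commun. Math. Phys. **122**, 175–202 (1989), doi:10.1007/BF01257412, bib `Balaban1989LargeFieldI` (cell
paper B15; PDF held `paper:balaban1989-cmp122-large-field-i`, journal page = PDF page + 174; pp. 181–182, 191, 198–200
READ AS IMAGES on the x2 renders `run/shared/lean/pub/pub-balaban/b2b-balaban-ref1/pages/1989-cmp122-large-field-I/
…-p007,p008,p017,p024,p025,p026-x2.png`).  [III] = [Balaban1988Convergent] (cell paper B14): (2.5) p. 255 = `B14.IsRj`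
(the sizes `R_j` are powers of `L`), the flow setting of `B14FlowStep` (`Flow`, `SatisfiesRG` = (I.0.20), `InInterval`,
`SmallnessFor`).  WHAT IS REPRODUCED: SKELETON row `B15.Eq1.89` (the p. 200 part of its printed proof; the p. 199 part is
`B15Ineq196Proof` ∕ `B15Bounds199`), unit `lit-balaban-r12` gen 8 (reader/typer and fold owner of block B15, Phase 2 in
own block), HOME `run/shared/lean/pub/lit-balaban/` (`lit-balaban-r12/ROWS-B15.md`).  Used BY NAME, nothing restated:
the typed lines of (1.24) `B15.BasicStep.SF149` ∕ `SF151` and `B15.PrelimIntegrations.SF124c` ∕ `cTop`, the schematic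
claim `B15.BasicStep.Claim189` (= `Claim129`), b01's p. 200 scalars `B15.BasicStep.bound200a` ∕ `bound200b`, the
(1.98) assembly `B15Ineq196Proof.ineq198` (its conclusion is the hypothesis shape used below), the `N₀`-bookkeeping of
`B15Claim179` (`IsN0`, `sols`, `Eq179`) and its flow version `B15Claim179Flow` (`exp_le_succ`, `exp_anti`).

THE PRINTED PASSAGE (p. 200, verbatim; `k₀ = k − N₀`).  *"… ≦ (2L^{−(k−j)} + 4α + O(1)B₃B₅M⁵·exp(−δdist(p, Λ))L^{−(k−j)})
ε_j(L^{k−j}η)², (1.98) on the j^{th} domain described above. Now we have to analyze this bound on all the domains in the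
definition (1.24). Consider Ω_m∖Ω_{m+1} for k₀ < m < k. We have j = k, and the exponential can be bounded by
exp(−δ(L^{−(k−m)}8MR_m + ⋯ + L^{−(k−k₀−2)}8MR_{k₀+2} + L^{−(k−k₀−1)}4MR_{k₀+1})) ≦ exp(−4δ(m − k₀)M), hence the last term
in the bound (1.98) can be made arbitrarily small for M large enough. Making it smaller than α, and taking α ≦ 1/8, we
estimate the right-hand side of (1.98) by (21/8)ε_kη² ≦ 3(1 − β(1/2))ε_kη² for m = k − 1, and (21/8)ε_kη² ≦
(1 − β(1/2))L₀^{2(k−m−1)}ε_kη² for the remaining m. Next, on the domain Ω^c_{k₀+1}∩Ω″^∼_{h+1} the right-hand side of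
(1.98) can be bounded by (4α + O(1)B₃B₅M⁵L₀^{−2(k−j)})ε_j(L^{k−j}η)², with an increased O(1). On the domain Z″_{j+1}∖Z″_j
for k₀ < j < k, and on Ω^c_{k₀+1}∖Z″_k for j = k, we have (4α + O(1)B₃B₅M⁵L₀^{−2(k−j)})ε_j(L^{k−j}η)² ≦
(1 − β)L₀^{2(j−k₀−1)}ε_j(L^{k−j}η)² if O(1)B₃B₅M⁵L₀^{−2(N₀−1)} ≦ 1/4. From the definition of the number N₀ (recall that it
is defined by the equation L^{−N₀+1}R_{k−N₀+1} = 1) we get O(1)B₃B₅M⁵L₀^{−2(N₀−1)} ≦ O(1)B₃B₅M⁵L₀²R_k^{−α₀}, where α₀ =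
(log L₀²)/(log L). The number on the right-hand side is ≦ 1/4 for R_k^{−α₀}, or γ sufficiently small. Finally, on the
domain Z″_{j+1}∖Z″_j for h < j ≦ k₀, and on Z″_{h+1}∩Ω″^∼_{h+1} for j = h, we have (4α + O(1)B₃B₅M⁵L₀^{−2(k−j)})
ε_j(L^{k−j}η)² ≦ (1 − β)ε_j(L^{k−j}η)², because k − j ≧ N₀ and we use the above bound again. Thus we have proved that the
configuration U″_{k,Z} satisfies all the conditions in the definition (1.24), hence χ″_k = 1, and the equality (1.89) is
proved."*  The lines of (1.24) at `n = N` (`j = k` in the notation of p. 182): on `Z″_{i+1}∖Z″_i` (`h ≦ i < k`; for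
`i = h`: `Z″_{h+1}∩Ω_h`) *"< (1 − β(1 − 2^{−(k−i+1)}))L₀^{2max{0,i−k₀−1}}ε_i(L^{k−i}η)²"* (`SF149`); on `Ω^c_{k₀+1}∖Z″_k`
*"< (1 − β½)L₀^{2(k−k₀−1)}ε_kη²"* and on `Ω_l∖Ω_{l+1}`, `k₀ < l ≦ k − 2`, *"< (1 − β½)L₀^{2(k−l−1)}ε_kη²"* (`SF151`); on
`Ω_{k−1}` *"< c(1 − β½)ε_kη²"* with *"c = 3 for j = k"* (`SF124c` ∕ `cTop`).  p. 191: *"for example if β ≦ 1/4 and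
L₀² ≦ (1/3)L"*; p. 198: *"We have assumed that β ≦ 1/4"*.

WHAT IS PROVED (0 `sorry`, no `def`, no new `Prop`; every declaration a theorem).
§1 `shellSum_ge`, `exp_shells_le` — the FIRST DISPLAY of p. 200: with the sizes `R_l = L^{s_l}` ((2.5) [III]), the
   `N₀`-equation `R_{k₀+1} = L^{k−k₀−1}` (p. 179 ∕ p. 200) and unit steps `s_l ≦ s_{l+1} + 1` (p. 177 «in some steps the
   number R_k decreases by the factor L^{−1}»; DERIVED along any [III] flow in `B15Claim179Flow.exp_le_succ`), every term
   `L^{−(k−l)}·8M·R_l` (`k₀+1 < l ≦ m`) is `≧ 8M` and the last one equals `4M`, so the exponent is `≧ 4(m − k₀)M` and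
   `exp(−δ·Σ) ≦ exp(−4δ(m − k₀)M)`; `exp_shells_le_along_flow` = the same with both inputs discharged along the flow
   (`B15Claim179.IsN0` + `B15Claim179Flow`).  The GEOMETRIC reading of the sum as a lower bound for `dist(p, Λ)`,
   `p ⊂ Ω_m∖Ω_{m+1}`, is an explicit hypothesis where used (`hdist`), NOT proved (admissible families are not modelled).
§2 `exists_M_lastTerm_lt` — *"can be made arbitrarily small for M large enough. Making it smaller than α"*:
   `c·M⁵·e^{−4δM} < α` for all `M ≧ M₀(c, δ, α)` (`δ, α > 0`); `lastTerm_le` chains `e^{−δdist} ≦ e^{−δΣ} ≦ e^{−4δ(m−k₀)M}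
   ≦ e^{−4δM}`.
§3 CASE `Ω_m∖Ω_{m+1}` (`j = k`): from the (1.98)-shape `dev < (2·1 + 4α + T·1)ε_kη²` (= `B15Ineq196Proof.ineq198` at
   `L^{−(k−j)} = 1`) and `T ≦ α ≦ 1/8`: `dev < (21/8)ε_kη²` (`caseA_lt`), hence the top line `SF124c dev (cTop k k) β (ε_kη²)`
   for `β ≦ 1/4` (`caseA_top`, via b01 `bound200a`) and the lines `SF151 dev β (L₀^{2(k−m−1)}) (ε_kη²)` for `k − m − 1 ≧ 1`,
   `L₀ ≧ 2` (`caseA_line`, via b01 `bound200b`).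
§4 THE «INCREASED O(1)» STEP (`caseB_bound`): `(2L^{−(k−j)} + 4α + X·e^{−δd}·L^{−(k−j)}) ≦ 4α + (2 + X)·L₀^{−2(k−j)}` for
   `δd ≧ 0` under `L₀² ≦ L` — implied by the printed `L₀² ≦ (1/3)L` of p. 191, NOT by the «e.g.» `L₀ = (L−1)/2` of p. 182
   for `L ≧ 6` (`Linv_le_L0inv`; located remark, cf. `B15.BasicStep` header on the two `L₀`-conditions).
§5 CASE `k₀ < j ≦ k` inside `Ω^c_{k₀+1}` (`caseB_coeff`, `caseB_shell`, `caseB_outer`): with `a = k − j`, `b = j − k₀ − 1`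
   (so `a + b = N₀ − 1`): `4α + X′L₀^{−2a} ≦ (1 − β)L₀^{2b}` from `X′L₀^{−2(N₀−1)} ≦ 1/4`, `α ≦ 1/8`, `β ≦ 1/4`, `L₀ ≧ 1` —
   the printed *"if"* EXACTLY (b01's `bound200c` needs the stronger `X′L₀^{−2a} ≦ 1/4`); then the (1.24) lines
   `SF149 dev β t (L₀^{2b}) εE` (any `0 ≦ t`, `β ≧ 0`) and, for `j = k`, `SF151 dev β (L₀^{2(k−k₀−1)}) εE`.
§6 CASE `h ≦ j ≦ k₀` (`caseC_coeff`, `caseC_shell`): `k − j ≧ N₀ > N₀ − 1` gives `X′L₀^{−2(k−j)} ≦ X′L₀^{−2(N₀−1)} ≦ 1/4`,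
   so `4α + X′L₀^{−2(k−j)} ≦ 3/4 ≦ 1 − β`, and the line `SF149 dev β t 1 εE` (`L₀^{2max{0,j−k₀−1}} = 1`).
§7 THE `N₀` DISPLAY (`L0inv_pow_le_rpow`): `L₀^{−2(N₀−1)} ≦ L₀²·R_k^{−α₀}`, `α₀ = (log L₀²)/(log L)`, from `R_{k−N₀+1} =
   L^{N₀−1}` and `R_k ≦ L·R_{k−N₀+1}` (`L > 1`, `L₀ ≧ 1`); along the flow `R_k ≦ R_{k−N₀+1}` (`B15Claim179Flow.exp_anti`),
   whence `L0inv_pow_le_rpow_along_flow`; and *"≦ 1/4 for R_k^{−α₀}, or γ sufficiently small"*: `rpow_Rk_le_of_isRj`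
   (`R_k^{−α₀} ≦ ((log γ⁻²)^p)^{−α₀}` for `0 < g_k ≦ γ < 1` by (2.5)).
§8 ASSEMBLY (`lines124N_of_bounds`): for abstract plaquette families of the four kinds of domains of (1.24) at `n = N`
   and per-plaquette bounds of the shapes derived on pp. 199–200 ((1.96) on `(Ω″^∼_{h+1})^c∩Ω_h`; (1.98) with `j = k` and
   `T ≦ α` on the `Ω_m∖Ω_{m+1}`; (1.98) with `dist ≧ 0` elsewhere), ALL the lines of (1.24) hold; `claim189_of_chain` —
   hence `B15.BasicStep.Claim189 remaining dropped` for `dropped` := «all the lines of (1.24) at n = N» as soon as the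
   remaining characteristic functions imply those bounds (the content of (1.90)–(1.98), hypothesis `hchain`).
HONEST SCOPE.  Real∕integer bookkeeping only.  Hypotheses that stay hypotheses: the ℍ-bounds (1.90), (1.94), the layer
bounds of p. 199 and (1.80) (leaves of `B15.PrelimIntegrations` ∕ `B15.BasicStep` ∕ `B15.Ineq180`), the geometry
(`dist(p, Λ) ≧` the shell sum; `dist ≧ 0`), the smallness clauses AS PRINTED (`O(1)′B₃B₅M⁵L₀^{−2(N₀−1)} ≦ 1/4`, the choice
of `M`, `α ≦ 1/8`, `β ≦ 1/4`, `2 ≦ L₀`, `L₀² ≦ L`), the implicit `0 ≦ ε_j ≦ 1/10`, `0 ≦ L^{−j} ≦ 1` already used by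
`B15Ineq196Proof`.  Value = the row's printed closing argument kernel-checked with every constant as printed; NOT summit
progress and no claim about the adjudicated mathematics.
-/

namespace Literature.MathematicalPhysics.QuantumFieldTheory.Balaban1983to89.B15Claim189Cases

open Literature.MathematicalPhysics.QuantumFieldTheory.Balaban1983to89
open B15.PrelimIntegrations B15.BasicStep B15Claim179 B15Claim179Flow B14FlowStep Filter Topology

/-! ## §1. The first display of p. 200: the exponential over the shells `Ω_l∖Ω_{l+1}`, `k₀ < l ≦ m` -/

/-- Exponent bookkeeping behind the first display of p. 200: if `R_{k₀+1} = L^{k−k₀−1}` (the `N₀`-equation, `k₀ = k − N₀`)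
and the sizes lose at most one factor `L` per step (`s_l ≦ s_{l+1} + 1`), then `R_l = L^{s_l} ≧ L^{k−l}` for
`k₀ + 1 ≦ l ≦ m`. [cite: Balaban1989LargeFieldI, p.200] -/
theorem exp_ge_of_unitSteps {s : ℕ → ℕ} {k k₀ m : ℕ} (hN0 : s (k₀ + 1) = k - k₀ - 1)
    (hunit : ∀ j, k₀ + 1 ≤ j → j < m → s j ≤ s (j + 1) + 1) {l : ℕ} (hl : k₀ + 1 ≤ l) (hlm : l ≤ m) :
    k - l ≤ s l := by
  have key : ∀ l, k₀ + 1 ≤ l → l ≤ m → s (k₀ + 1) ≤ s l + (l - (k₀ + 1)) := by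
    intro l hl hlm
    induction l, hl using Nat.le_induction with
    | base => simp
    | succ l hl ih =>
      have h1 := ih (by omega)
      have h2 := hunit l hl (by omega)
      omega
  have := key l hl hlm
  omega

/-- `L^{s}/L^{a} ≧ 1` for `a ≦ s`, `L ≧ 1`. [cite: Balaban1989LargeFieldI, p.200] -/
private theorem one_le_inv_pow_mul_pow {L : ℝ} (hL : 1 ≤ L) {a b : ℕ} (hab : a ≤ b) :
    1 ≤ (L ^ a)⁻¹ * L ^ b := by
  have ha : 0 < L ^ a := by positivity
  rw [inv_mul_eq_div, le_div_iff₀ ha, one_mul]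
  exact pow_le_pow_right₀ hL hab

/-- **p. 200, the exponent of the first display.**  For sizes `R_l = L^{s_l}` with `R_{k₀+1} = L^{k−k₀−1}` (the
`N₀`-equation *"L^{−N₀+1}R_{k−N₀+1} = 1"*, `k₀ = k − N₀`) and unit steps `s_l ≦ s_{l+1} + 1`, `M ≧ 0`, `k₀ + 1 ≦ m` (print: `m < k`):
`4(m − k₀)M ≦ L^{−(k−m)}8MR_m + ⋯ + L^{−(k−k₀−2)}8MR_{k₀+2} + L^{−(k−k₀−1)}4MR_{k₀+1}` (every `8M`-term is `≧ 8M ≧ 4M`, the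
last term equals `4M`). [cite: Balaban1989LargeFieldI, p.200] -/
theorem shellSum_ge {L : ℕ} (hL : 2 ≤ L) {M : ℝ} (hM : 0 ≤ M) {s : ℕ → ℕ} {k k₀ m : ℕ}
    (hN0 : s (k₀ + 1) = k - k₀ - 1) (hunit : ∀ j, k₀ + 1 ≤ j → j < m → s j ≤ s (j + 1) + 1)
    (hm : k₀ + 1 ≤ m) :
    4 * ((m : ℝ) - k₀) * M ≤
      ∑ l ∈ Finset.Ioc (k₀ + 1) m, ((L : ℝ) ^ (k - l))⁻¹ * 8 * M * (L : ℝ) ^ s l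
        + ((L : ℝ) ^ (k - k₀ - 1))⁻¹ * 4 * M * (L : ℝ) ^ s (k₀ + 1) := by
  have hL1 : (1 : ℝ) ≤ L := by exact_mod_cast (le_trans (by norm_num) hL)
  have hlast : 4 * M ≤ ((L : ℝ) ^ (k - k₀ - 1))⁻¹ * 4 * M * (L : ℝ) ^ s (k₀ + 1) := by
    have h1 := one_le_inv_pow_mul_pow hL1 (le_of_eq hN0.symm)
    calc 4 * M = 4 * M * 1 := by ring
      _ ≤ 4 * M * (((L : ℝ) ^ (k - k₀ - 1))⁻¹ * (L : ℝ) ^ s (k₀ + 1)) :=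
          mul_le_mul_of_nonneg_left h1 (by positivity)
      _ = ((L : ℝ) ^ (k - k₀ - 1))⁻¹ * 4 * M * (L : ℝ) ^ s (k₀ + 1) := by ring
  have hterm : ∀ l ∈ Finset.Ioc (k₀ + 1) m, 4 * M ≤ ((L : ℝ) ^ (k - l))⁻¹ * 8 * M * (L : ℝ) ^ s l := by
    intro l hl
    rw [Finset.mem_Ioc] at hl
    have hs : k - l ≤ s l := exp_ge_of_unitSteps hN0 hunit (by omega) hl.2
    have h1 := one_le_inv_pow_mul_pow hL1 hs
    calc 4 * M ≤ 8 * M * 1 := by linarith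
      _ ≤ 8 * M * (((L : ℝ) ^ (k - l))⁻¹ * (L : ℝ) ^ s l) := mul_le_mul_of_nonneg_left h1 (by positivity)
      _ = ((L : ℝ) ^ (k - l))⁻¹ * 8 * M * (L : ℝ) ^ s l := by ring
  have hsum := Finset.sum_le_sum hterm
  rw [Finset.sum_const, Nat.card_Ioc, nsmul_eq_mul] at hsum
  have hcast : ((m - (k₀ + 1) : ℕ) : ℝ) = (m : ℝ) - k₀ - 1 := by
    rw [Nat.cast_sub hm]; push_cast; ring
  rw [hcast] at hsum
  have e : 4 * ((m : ℝ) - k₀) * M = ((m : ℝ) - k₀ - 1) * (4 * M) + 4 * M := by ring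
  rw [e]
  exact add_le_add hsum hlast

/-- **p. 200, first display**, verbatim: *"the exponential can be bounded by exp(−δ(L^{−(k−m)}8MR_m + ⋯ +
L^{−(k−k₀−2)}8MR_{k₀+2} + L^{−(k−k₀−1)}4MR_{k₀+1})) ≦ exp(−4δ(m − k₀)M)"* — the displayed inequality between the two
exponentials, for `δ ≧ 0`, under the hypotheses of `shellSum_ge`. [cite: Balaban1989LargeFieldI, p.200] -/
theorem exp_shells_le {L : ℕ} (hL : 2 ≤ L) {M δ : ℝ} (hM : 0 ≤ M) (hδ : 0 ≤ δ) {s : ℕ → ℕ} {k k₀ m : ℕ}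
    (hN0 : s (k₀ + 1) = k - k₀ - 1) (hunit : ∀ j, k₀ + 1 ≤ j → j < m → s j ≤ s (j + 1) + 1)
    (hm : k₀ + 1 ≤ m) :
    Real.exp (-(δ * (∑ l ∈ Finset.Ioc (k₀ + 1) m, ((L : ℝ) ^ (k - l))⁻¹ * 8 * M * (L : ℝ) ^ s l
        + ((L : ℝ) ^ (k - k₀ - 1))⁻¹ * 4 * M * (L : ℝ) ^ s (k₀ + 1))))
      ≤ Real.exp (-(4 * δ * ((m : ℝ) - k₀) * M)) := by
  have h := shellSum_ge hL hM hN0 hunit hm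
  apply Real.exp_le_exp.mpr
  have := mul_le_mul_of_nonneg_left h hδ
  linarith

section AlongFlow

variable (F : Flow) (K : ℕ) {γ β' β₀ : ℝ} {L p : ℕ}

/-- **The first display of p. 200 ALONG ANY RENORMALIZATION GROUP FLOW of the [III] setting** ((I.0.20) up to `K`,
`0 < g_j ≦ γ`, `0 ≦ β_{j+1}(g_j) ≦ β′`, `SmallnessFor γ β′ β₀ L p`, sizes `R_j = L^{s_j}` as in (2.5) [III]): for `N₀` the
integer of p. 179 (`B15Claim179.IsN0 s k N₀`), `k₀ = k − N₀`, `k₀ + 1 ≦ m ≦ k ≦ K`, `M, δ ≧ 0`, the displayed inequality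
holds — the unit steps come from `B15Claim179Flow.exp_le_succ`. [cite: Balaban1989LargeFieldI, p.200] -/
theorem exp_shells_le_along_flow (S : SmallnessFor γ β' β₀ L p) (hrg : F.SatisfiesRG K) (hI : F.InInterval γ K)
    (hub : ∀ j, j < K → F.β (j + 1) (F.g j) ≤ β') (hlb : ∀ j, j < K → 0 ≤ F.β (j + 1) (F.g j))
    {s : ℕ → ℕ} (hs : ∀ j, j ≤ K → B14.IsRj L p (F.g j) (L ^ s j)) {k N₀ m : ℕ} (hkK : k ≤ K)
    (hN : IsN0 s k N₀) (hm : k - N₀ + 1 ≤ m) (hmk : m ≤ k) {M δ : ℝ} (hM : 0 ≤ M) (hδ : 0 ≤ δ) :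
    Real.exp (-(δ * (∑ l ∈ Finset.Ioc (k - N₀ + 1) m, ((L : ℝ) ^ (k - l))⁻¹ * 8 * M * (L : ℝ) ^ s l
        + ((L : ℝ) ^ (k - (k - N₀) - 1))⁻¹ * 4 * M * (L : ℝ) ^ s (k - N₀ + 1))))
      ≤ Real.exp (-(4 * δ * ((m : ℝ) - (k - N₀ : ℕ)) * M)) := by
  obtain ⟨hmem, -⟩ := hN
  obtain ⟨⟨hN1, hNk⟩, hEq⟩ := mem_sols.1 hmem
  have hN0 : s (k - N₀ + 1) = k - (k - N₀) - 1 := by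
    unfold Eq179 at hEq; rw [hEq]; omega
  have hunit : ∀ j, k - N₀ + 1 ≤ j → j < m → s j ≤ s (j + 1) + 1 :=
    fun j _ hjm => exp_le_succ F K S hrg hI hub hlb hs (by omega)
  exact exp_shells_le S.hL hM hδ hN0 hunit hm

end AlongFlow

/-! ## §2. «hence the last term in the bound (1.98) can be made arbitrarily small for M large enough» -/

/-- **p. 200**, verbatim: *"hence the last term in the bound (1.98) can be made arbitrarily small for M large enough.
Making it smaller than α"* — for every `c`, `δ > 0`, `α > 0` there is `M₀` with `c·M⁵·e^{−4δM} < α` for all `M ≧ M₀`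
(`x⁵e^{−x} → 0`, Mathlib `Real.tendsto_pow_mul_exp_neg_atTop_nhds_zero`). [cite: Balaban1989LargeFieldI, p.200] -/
theorem exists_M_lastTerm_lt (c : ℝ) {δ α : ℝ} (hδ : 0 < δ) (hα : 0 < α) :
    ∃ M₀ : ℝ, ∀ M, M₀ ≤ M → c * M ^ 5 * Real.exp (-(4 * δ * M)) < α := by
  have h1 : Tendsto (fun M : ℝ => 4 * δ * M) atTop atTop := tendsto_id.const_mul_atTop (by positivity)
  have h2 := (Real.tendsto_pow_mul_exp_neg_atTop_nhds_zero 5).comp h1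
  have h3 := (h2.const_mul ((4 * δ)⁻¹ ^ 5)).const_mul c
  rw [mul_zero, mul_zero] at h3
  obtain ⟨M₀, hM₀⟩ := Filter.eventually_atTop.1 (h3.eventually (gt_mem_nhds hα))
  refine ⟨M₀, fun M hM => ?_⟩
  have h := hM₀ M hM
  have hδ0 : (4 * δ) ≠ 0 := by positivity
  have e : c * ((4 * δ)⁻¹ ^ 5 * (((fun x : ℝ => x ^ 5 * Real.exp (-x)) ∘ fun M : ℝ => 4 * δ * M) M))
      = c * M ^ 5 * Real.exp (-(4 * δ * M)) := by
    simp only [Function.comp]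
    field_simp
  rw [e] at h
  exact h

/-- The exponential of the last term of (1.98) on `Ω_m∖Ω_{m+1}`: if `dist(p, Λ)` is at least the shell sum `Σ` of the
first display (hypothesis `hdist` — the geometry of the admissible families, NOT modelled), `Σ ≧ 4(m − k₀)M`
(`shellSum_ge`, hypothesis `hS` with `g = m − k₀ ≧ 1`), `δ, M ≧ 0`, then `A·e^{−δdist} ≦ A·e^{−4δM}` for any `A ≧ 0`.
[cite: Balaban1989LargeFieldI, p.200] -/
theorem lastTerm_le {A δ dist Ssum M g : ℝ} (hA : 0 ≤ A) (hδ : 0 ≤ δ) (hM : 0 ≤ M) (hdist : Ssum ≤ dist)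
    (hS : 4 * g * M ≤ Ssum) (hg : 1 ≤ g) :
    A * Real.exp (-δ * dist) ≤ A * Real.exp (-(4 * δ * M)) := by
  apply mul_le_mul_of_nonneg_left _ hA
  apply Real.exp_le_exp.mpr
  have h1 : δ * Ssum ≤ δ * dist := mul_le_mul_of_nonneg_left hdist hδ
  have h2 : 4 * 1 * M ≤ 4 * g * M := by
    apply mul_le_mul_of_nonneg_right _ hM
    linarith
  have h3 : δ * (4 * M) ≤ δ * Ssum := mul_le_mul_of_nonneg_left (by linarith) hδ
  nlinarith

/-! ## §3. The domains `Ω_m∖Ω_{m+1}`, `k₀ < m < k` (`j = k`): `(21/8)ε_kη²` and the two top lines of (1.24) -/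

/-- **p. 200**, verbatim: *"Making it smaller than α, and taking α ≦ 1/8, we estimate the right-hand side of (1.98) by
(21/8)ε_kη²"* — from the (1.98)-shape with `j = k` (`L^{−(k−j)} = 1`, `ε_j(L^{k−j}η)² = ε_kη² =: E`; the conclusion of
`B15Ineq196Proof.ineq198` with `Lkj = 1`), last-term coefficient `T ≦ α`, `α ≦ 1/8`, `E ≧ 0`: `dev < (21/8)E`.
[cite: Balaban1989LargeFieldI, p.200] -/
theorem caseA_lt {dev α T E : ℝ} (h : dev < (2 * 1 + 4 * α + T * 1) * E) (hT : T ≤ α) (hα : α ≤ 1 / 8)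
    (hE : 0 ≤ E) : dev < 21 / 8 * E := by
  have h1 : (2 * 1 + 4 * α + T * 1) * E ≤ (21 / 8) * E := by
    apply mul_le_mul_of_nonneg_right _ hE
    linarith
  linarith

/-- **p. 200, the case `m = k − 1`**, verbatim: *"(21/8)ε_kη² ≦ 3(1 − β(1/2))ε_kη² for m = k − 1"* — the TOP line of (1.24)
at `j = k` (`c = 3`, `B15.PrelimIntegrations.cTop k k = 3`), for `β ≦ 1/4` (b01 `bound200a`): `SF124c dev (cTop k k) β E`.
[cite: Balaban1989LargeFieldI, p.200] -/
theorem caseA_top {dev α T E β : ℝ} (k : ℕ) (h : dev < (2 * 1 + 4 * α + T * 1) * E) (hT : T ≤ α)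
    (hα : α ≤ 1 / 8) (hβ : β ≤ 1 / 4) (hE : 0 ≤ E) : SF124c dev (cTop k k) β E := by
  unfold SF124c cTop
  simp only [lt_self_iff_false, if_false]
  have h1 := caseA_lt h hT hα hE
  have h2 : (21 / 8 : ℝ) ≤ 3 * (1 - β / 2) := bound200a.2 hβ
  have h3 : 21 / 8 * E ≤ 3 * (1 - β / 2) * E := mul_le_mul_of_nonneg_right h2 hE
  linarith

/-- **p. 200, the remaining `m`** (`k₀ < m ≦ k − 2`, `n = k − m − 1 ≧ 1`), verbatim: *"and (21/8)ε_kη² ≦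
(1 − β(1/2))L₀^{2(k−m−1)}ε_kη² for the remaining m"* — the `(1 − β½)`-line of (1.24) on `Ω_m∖Ω_{m+1}`, for `β ≦ 1/4`,
`L₀ ≧ 2` (b01 `bound200b`): `SF151 dev β (L₀^{2n}) E`. [cite: Balaban1989LargeFieldI, p.200] -/
theorem caseA_line {dev α T E β L₀ : ℝ} {n : ℕ} (h : dev < (2 * 1 + 4 * α + T * 1) * E) (hT : T ≤ α)
    (hα : α ≤ 1 / 8) (hβ : β ≤ 1 / 4) (hL₀ : 2 ≤ L₀) (hn : 1 ≤ n) (hE : 0 ≤ E) :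
    SF151 dev β (L₀ ^ (2 * n)) E := by
  unfold SF151
  have h1 := caseA_lt h hT hα hE
  have h2 : (21 / 8 : ℝ) ≤ (1 - β / 2) * L₀ ^ (2 * n) := bound200b hβ hL₀ hn
  have h3 : 21 / 8 * E ≤ (1 - β / 2) * L₀ ^ (2 * n) * E := mul_le_mul_of_nonneg_right h2 hE
  linarith

/-! ## §4. The «increased O(1)» step on the domains inside `Ω^c_{k₀+1}` -/

/-- `L^{−a} ≦ L₀^{−2a}` for `L₀² ≦ L`, `L₀ ≧ 1` — what the passage from the base `L` of (1.98) to the base `L₀²` of p. 200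
uses; `L₀² ≦ L` is implied by the printed *"L₀² ≦ (1/3)L"* (p. 191), not by the «e.g.» `L₀ = (L−1)/2` of p. 182 when
`L ≧ 6`. [cite: Balaban1989LargeFieldI, p.200] -/
theorem Linv_le_L0inv {L L₀ : ℝ} (hL₀ : 1 ≤ L₀) (hL₀L : L₀ ^ 2 ≤ L) (a : ℕ) :
    (L ^ a)⁻¹ ≤ ((L₀ ^ 2) ^ a)⁻¹ := by
  have h0 : 0 < (L₀ ^ 2) ^ a := by positivity
  exact inv_anti₀ h0 (pow_le_pow_left₀ (by positivity) hL₀L a)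

/-- **p. 200**, verbatim: *"Next, on the domain Ω^c_{k₀+1}∩Ω″^∼_{h+1} the right-hand side of (1.98) can be bounded by
(4α + O(1)B₃B₅M⁵L₀^{−2(k−j)})ε_j(L^{k−j}η)², with an increased O(1)"* — from the (1.98)-shape (conclusion of
`B15Ineq196Proof.ineq198`: `dev < (2·Lkj + 4α + X·e^{−δdist}·Lkj)·εE`, `Lkj = L^{−(k−j)}`) with `dist ≧ 0` only
(`0 ≦ δ·dist`), `0 ≦ Lkj ≦ L0inv` (`= L₀^{−2(k−j)}`, `Linv_le_L0inv`), `X ≧ 0`, `εE ≧ 0` and the increased constant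
`X′ ≧ 2 + X`: `dev < (4α + X′·L0inv)·εE`. [cite: Balaban1989LargeFieldI, p.200] -/
theorem caseB_bound {dev α X δ dist Lkj L0inv εE X' : ℝ}
    (h : dev < (2 * Lkj + 4 * α + X * Real.exp (-δ * dist) * Lkj) * εE) (hδd : 0 ≤ δ * dist) (hX : 0 ≤ X)
    (hLkj0 : 0 ≤ Lkj) (hLkj : Lkj ≤ L0inv) (hX' : 2 + X ≤ X') (hεE : 0 ≤ εE) :
    dev < (4 * α + X' * L0inv) * εE := by
  have hE1 : Real.exp (-δ * dist) ≤ 1 := by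
    rw [Real.exp_le_one_iff]; linarith
  have hE0 : 0 ≤ Real.exp (-δ * dist) := Real.exp_nonneg _
  have h1 : X * Real.exp (-δ * dist) * Lkj ≤ X * Lkj := by
    have := mul_le_mul_of_nonneg_left hE1 hX
    calc X * Real.exp (-δ * dist) * Lkj ≤ X * 1 * Lkj := mul_le_mul_of_nonneg_right (by linarith) hLkj0
      _ = X * Lkj := by ring
  have h2 : 2 * Lkj + X * Lkj = (2 + X) * Lkj := by ring
  have h3 : (2 + X) * Lkj ≤ X' * L0inv := by
    have hL0 : 0 ≤ L0inv := hLkj0.trans hLkj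
    calc (2 + X) * Lkj ≤ X' * Lkj := mul_le_mul_of_nonneg_right hX' hLkj0
      _ ≤ X' * L0inv := mul_le_mul_of_nonneg_left hLkj (by linarith)
  have h4 : (2 * Lkj + 4 * α + X * Real.exp (-δ * dist) * Lkj) * εE ≤ (4 * α + X' * L0inv) * εE := by
    apply mul_le_mul_of_nonneg_right _ hεE
    linarith
  linarith

/-! ## §5. The domains `Z″_{j+1}∖Z″_j`, `k₀ < j < k`, and `Ω^c_{k₀+1}∖Z″_k` (`j = k`) -/

/-- **p. 200**, verbatim: *"On the domain Z″_{j+1}∖Z″_j for k₀ < j < k, and on Ω^c_{k₀+1}∖Z″_k for j = k, we have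
(4α + O(1)B₃B₅M⁵L₀^{−2(k−j)})ε_j(L^{k−j}η)² ≦ (1 − β)L₀^{2(j−k₀−1)}ε_j(L^{k−j}η)² if O(1)B₃B₅M⁵L₀^{−2(N₀−1)} ≦ 1/4"* — the
numerical coefficient: with `a = k − j`, `b = j − k₀ − 1` (`a + b = k − k₀ − 1 = N₀ − 1`), `X′L₀^{−2(a+b)} ≦ 1/4`,
`α ≦ 1/8`, `β ≦ 1/4`, `L₀ ≧ 1`: `4α + X′L₀^{−2a} ≦ (1 − β)L₀^{2b}` (`X′L₀^{−2a} = X′L₀^{−2(a+b)}L₀^{2b} ≦ ¼L₀^{2b}`,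
`4α ≦ ½ ≦ ½L₀^{2b}`, `¾ ≦ 1 − β`). [cite: Balaban1989LargeFieldI, p.200] -/
theorem caseB_coeff {α β X' L₀ : ℝ} {a b : ℕ} (hα : α ≤ 1 / 8) (hβ : β ≤ 1 / 4) (hL₀ : 1 ≤ L₀)
    (hsmall : X' * ((L₀ ^ 2) ^ (a + b))⁻¹ ≤ 1 / 4) :
    4 * α + X' * ((L₀ ^ 2) ^ a)⁻¹ ≤ (1 - β) * (L₀ ^ 2) ^ b := by
  have hQ : 1 ≤ (L₀ ^ 2) ^ b := one_le_pow₀ (by nlinarith)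
  have hQ0 : 0 < (L₀ ^ 2) ^ b := by positivity
  have ha0 : 0 < (L₀ ^ 2) ^ a := by positivity
  -- X' L₀^{-2a} = (X' L₀^{-2(a+b)}) · L₀^{2b}
  have e : X' * ((L₀ ^ 2) ^ a)⁻¹ = X' * ((L₀ ^ 2) ^ (a + b))⁻¹ * (L₀ ^ 2) ^ b := by
    rw [pow_add]; field_simp
  have h1 : X' * ((L₀ ^ 2) ^ a)⁻¹ ≤ 1 / 4 * (L₀ ^ 2) ^ b := by
    rw [e]; exact mul_le_mul_of_nonneg_right hsmall hQ0.le
  nlinarith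

/-- The `Z″_{j+1}∖Z″_j` line of (1.24) at `n = N` for `k₀ < j < k`: from the bound `dev < (4α + X′L₀^{−2(k−j)})εE` of
`caseB_bound` and `caseB_coeff` (`a = k − j`, `b = j − k₀ − 1`), the printed line *"< (1 − β(1 − 2^{−(k−j+1)}))
L₀^{2max{0,j−k₀−1}}ε_j(L^{k−j}η)²"* holds: `SF149 dev β t ((L₀²)^b) εE` for every `0 ≦ t` (`t = 2^{−(k−j+1)}`), `β ≧ 0`,
since `1 − β ≦ 1 − β(1 − t)`. [cite: Balaban1989LargeFieldI, p.200] -/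
theorem caseB_shell {dev α β X' L₀ εE t : ℝ} {a b : ℕ} (h : dev < (4 * α + X' * ((L₀ ^ 2) ^ a)⁻¹) * εE)
    (hα : α ≤ 1 / 8) (hβ0 : 0 ≤ β) (hβ : β ≤ 1 / 4) (hL₀ : 1 ≤ L₀)
    (hsmall : X' * ((L₀ ^ 2) ^ (a + b))⁻¹ ≤ 1 / 4) (ht : 0 ≤ t) (hεE : 0 ≤ εE) :
    SF149 dev β t ((L₀ ^ 2) ^ b) εE := by
  unfold SF149
  have h1 := caseB_coeff (a := a) (b := b) hα hβ hL₀ hsmall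
  have hQ0 : 0 ≤ (L₀ ^ 2) ^ b := by positivity
  have h2 : (1 - β) * (L₀ ^ 2) ^ b ≤ (1 - β * (1 - t)) * (L₀ ^ 2) ^ b := by
    apply mul_le_mul_of_nonneg_right _ hQ0
    nlinarith
  have h3 : (4 * α + X' * ((L₀ ^ 2) ^ a)⁻¹) * εE ≤ (1 - β * (1 - t)) * (L₀ ^ 2) ^ b * εE :=
    mul_le_mul_of_nonneg_right (h1.trans h2) hεE
  linarith

/-- The `Ω^c_{k₀+1}∖Z″_k` line of (1.24) at `n = N` (`j = k`, `a = 0`, `b = k − k₀ − 1 = N₀ − 1`): from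
`dev < (4α + X′·1)ε_kη²` and `X′L₀^{−2(N₀−1)} ≦ 1/4` the printed line *"< (1 − β½)L₀^{2(k−k₀−1)}ε_kη²"* holds:
`SF151 dev β ((L₀²)^b) E` (`1 − β ≦ 1 − β½` for `β ≧ 0`). [cite: Balaban1989LargeFieldI, p.200] -/
theorem caseB_outer {dev α β X' L₀ E : ℝ} {b : ℕ} (h : dev < (4 * α + X' * ((L₀ ^ 2) ^ 0)⁻¹) * E)
    (hα : α ≤ 1 / 8) (hβ0 : 0 ≤ β) (hβ : β ≤ 1 / 4) (hL₀ : 1 ≤ L₀)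
    (hsmall : X' * ((L₀ ^ 2) ^ b)⁻¹ ≤ 1 / 4) (hE : 0 ≤ E) :
    SF151 dev β ((L₀ ^ 2) ^ b) E := by
  unfold SF151
  have h1 := caseB_coeff (a := 0) (b := b) hα hβ hL₀ (by simpa using hsmall)
  have hQ0 : 0 ≤ (L₀ ^ 2) ^ b := by positivity
  have h2 : (1 - β) * (L₀ ^ 2) ^ b ≤ (1 - β / 2) * (L₀ ^ 2) ^ b := by
    apply mul_le_mul_of_nonneg_right _ hQ0
    linarith
  have h3 : (4 * α + X' * ((L₀ ^ 2) ^ 0)⁻¹) * E ≤ (1 - β / 2) * (L₀ ^ 2) ^ b * E :=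
    mul_le_mul_of_nonneg_right (h1.trans h2) hE
  linarith

/-! ## §6. The domains `Z″_{j+1}∖Z″_j`, `h < j ≦ k₀`, and `Z″_{h+1}∩Ω″^∼_{h+1}` (`j = h`): `k − j ≧ N₀` -/

/-- **p. 200**, verbatim: *"Finally, on the domain Z″_{j+1}∖Z″_j for h < j ≦ k₀, and on Z″_{h+1}∩Ω″^∼_{h+1} for j = h, we
have (4α + O(1)B₃B₅M⁵L₀^{−2(k−j)})ε_j(L^{k−j}η)² ≦ (1 − β)ε_j(L^{k−j}η)², because k − j ≧ N₀ and we use the above bound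
again"* — the coefficient: for `n ≦ a` (`n = N₀ − 1 < N₀ ≦ k − j = a`), `X′L₀^{−2n} ≦ 1/4`, `α ≦ 1/8`, `β ≦ 1/4`, `L₀ ≧ 1`,
`X′ ≧ 0`: `4α + X′L₀^{−2a} ≦ 1 − β`. [cite: Balaban1989LargeFieldI, p.200] -/
theorem caseC_coeff {α β X' L₀ : ℝ} {a n : ℕ} (hα : α ≤ 1 / 8) (hβ : β ≤ 1 / 4) (hL₀ : 1 ≤ L₀) (hX' : 0 ≤ X')
    (hna : n ≤ a) (hsmall : X' * ((L₀ ^ 2) ^ n)⁻¹ ≤ 1 / 4) : 4 * α + X' * ((L₀ ^ 2) ^ a)⁻¹ ≤ 1 - β := by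
  have hn0 : 0 < (L₀ ^ 2) ^ n := by positivity
  have hmono : ((L₀ ^ 2) ^ a)⁻¹ ≤ ((L₀ ^ 2) ^ n)⁻¹ :=
    inv_anti₀ hn0 (pow_le_pow_right₀ (by nlinarith) hna)
  have h1 : X' * ((L₀ ^ 2) ^ a)⁻¹ ≤ 1 / 4 := (mul_le_mul_of_nonneg_left hmono hX').trans hsmall
  linarith

/-- The `Z″_{j+1}∖Z″_j` line of (1.24) at `n = N` for `h ≦ j ≦ k₀` (there `L₀^{2max{0,j−k₀−1}} = 1`): from
`dev < (4α + X′L₀^{−2(k−j)})εE`, `k − j ≧ N₀ > n = N₀ − 1` and `X′L₀^{−2n} ≦ 1/4` the printed line holds: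
`SF149 dev β t 1 εE` for every `0 ≦ t`, `β ≧ 0`. [cite: Balaban1989LargeFieldI, p.200] -/
theorem caseC_shell {dev α β X' L₀ εE t : ℝ} {a n : ℕ} (h : dev < (4 * α + X' * ((L₀ ^ 2) ^ a)⁻¹) * εE)
    (hα : α ≤ 1 / 8) (hβ0 : 0 ≤ β) (hβ : β ≤ 1 / 4) (hL₀ : 1 ≤ L₀) (hX' : 0 ≤ X') (hna : n ≤ a)
    (hsmall : X' * ((L₀ ^ 2) ^ n)⁻¹ ≤ 1 / 4) (ht : 0 ≤ t) (hεE : 0 ≤ εE) : SF149 dev β t 1 εE := by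
  unfold SF149
  have h1 := caseC_coeff hα hβ hL₀ hX' hna hsmall
  have h2 : 1 - β ≤ (1 - β * (1 - t)) * 1 := by nlinarith
  have h3 : (4 * α + X' * ((L₀ ^ 2) ^ a)⁻¹) * εE ≤ (1 - β * (1 - t)) * 1 * εE :=
    mul_le_mul_of_nonneg_right (h1.trans h2) hεE
  linarith

/-! ## §7. The `N₀` display: `L₀^{−2(N₀−1)} ≦ L₀²R_k^{−α₀}`, `α₀ = (log L₀²)/(log L)` -/

/-- **p. 200, the `N₀` display**, verbatim: *"From the definition of the number N₀ (recall that it is defined by the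
equation L^{−N₀+1}R_{k−N₀+1} = 1) we get O(1)B₃B₅M⁵L₀^{−2(N₀−1)} ≦ O(1)B₃B₅M⁵L₀²R_k^{−α₀}, where α₀ = (log L₀²)/(log L)"* —
the factor `O(1)B₃B₅M⁵ ≧ 0` cancelled: for `L > 1`, `L₀ ≧ 1`, `R′ = R_{k−N₀+1} = L^{n}` (`n = N₀ − 1`) and
`0 < R_k ≦ L·R′`: `L₀^{−2n} ≦ L₀²·R_k^{−α₀}` (indeed `L₀² = L^{α₀}`, `L₀^{−2n} = R′^{−α₀} ≦ (R_k/L)^{−α₀} = L₀²R_k^{−α₀}`).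
[cite: Balaban1989LargeFieldI, p.200] -/
theorem L0inv_pow_le_rpow {L L₀ Rk R' : ℝ} (hL : 1 < L) (hL₀ : 1 ≤ L₀) {n : ℕ} (hR' : R' = L ^ n)
    (hRk : 0 < Rk) (hmono : Rk ≤ L * R') :
    ((L₀ ^ 2) ^ n)⁻¹ ≤ L₀ ^ 2 * Rk ^ (-(Real.log (L₀ ^ 2) / Real.log L)) := by
  set α₀ := Real.log (L₀ ^ 2) / Real.log L with hα₀
  have hL0 : 0 < L := by linarith
  have hlogL : 0 < Real.log L := Real.log_pos hL
  have hL₀sq : 1 ≤ L₀ ^ 2 := by nlinarith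
  have hL₀pos : 0 < L₀ ^ 2 := by positivity
  have hα₀0 : 0 ≤ α₀ := div_nonneg (Real.log_nonneg hL₀sq) hlogL.le
  -- L^{α₀} = L₀²
  have hLα : L ^ α₀ = L₀ ^ 2 := by
    rw [Real.rpow_def_of_pos hL0, hα₀]
    rw [show Real.log L * (Real.log (L₀ ^ 2) / Real.log L) = Real.log (L₀ ^ 2) by field_simp]
    exact Real.exp_log hL₀pos
  -- R'^{−α₀} = L₀^{−2n}
  have hR'pos : 0 < R' := by rw [hR']; positivity
  have hR'α : R' ^ (-α₀) = ((L₀ ^ 2) ^ n)⁻¹ := by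
    rw [Real.rpow_neg hR'pos.le, hR', ← Real.rpow_natCast L n, ← Real.rpow_mul hL0.le,
      mul_comm, Real.rpow_mul hL0.le, hLα, Real.rpow_natCast]
  -- (R_k/L)^{−α₀} ≦ ... : antitone in the base
  have hdiv : Rk / L ≤ R' := by rw [div_le_iff₀ hL0]; linarith
  have hdivpos : 0 < Rk / L := div_pos hRk hL0
  have h1 : R' ^ (-α₀) ≤ (Rk / L) ^ (-α₀) := Real.rpow_le_rpow_of_nonpos hdivpos hdiv (by linarith)
  have h2 : (Rk / L) ^ (-α₀) = L₀ ^ 2 * Rk ^ (-α₀) := by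
    rw [Real.div_rpow hRk.le hL0.le, Real.rpow_neg hL0.le, hLα]
    field_simp
  rw [← hR'α]
  calc R' ^ (-α₀) ≤ (Rk / L) ^ (-α₀) := h1
    _ = L₀ ^ 2 * Rk ^ (-α₀) := h2

section AlongFlow2

variable (F : Flow) (K : ℕ) {γ β' β₀ : ℝ} {L p : ℕ}

/-- **The `N₀` display ALONG THE FLOW**: for sizes `R_j = L^{s_j}` of (2.5) [III] along a flow with `β ≧ 0` the sizes do
not increase with the scale index (`B15Claim179Flow.exp_anti`: `R_k ≦ R_{k−N₀+1} ≦ L·R_{k−N₀+1}`), so with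
`B15Claim179.IsN0 s k N₀` (`R_{k−N₀+1} = L^{N₀−1}`), `L₀ ≧ 1`: `L₀^{−2(N₀−1)} ≦ L₀²·R_k^{−α₀}`. [cite: Balaban1989LargeFieldI, p.200] -/
theorem L0inv_pow_le_rpow_along_flow (S : SmallnessFor γ β' β₀ L p) (hrg : F.SatisfiesRG K)
    (hI : F.InInterval γ K) (hlb : ∀ j, j < K → 0 ≤ F.β (j + 1) (F.g j)) {s : ℕ → ℕ}
    (hs : ∀ j, j ≤ K → B14.IsRj L p (F.g j) (L ^ s j)) {k N₀ : ℕ} (hkK : k ≤ K) (hN : IsN0 s k N₀)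
    {L₀ : ℝ} (hL₀ : 1 ≤ L₀) :
    ((L₀ ^ 2) ^ (N₀ - 1))⁻¹ ≤
      L₀ ^ 2 * ((L : ℝ) ^ s k) ^ (-(Real.log (L₀ ^ 2) / Real.log (L : ℝ))) := by
  obtain ⟨hmem, -⟩ := hN
  obtain ⟨⟨hN1, hNk⟩, hEq⟩ := mem_sols.1 hmem
  unfold Eq179 at hEq
  have hL1 : (1 : ℝ) < L := by exact_mod_cast (lt_of_lt_of_le (by norm_num) S.hL)
  have hanti : s k ≤ s (k - N₀ + 1) := exp_anti F K S hrg hI hlb hs (by omega) hkK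
  have hmono : (L : ℝ) ^ s k ≤ (L : ℝ) * (L : ℝ) ^ s (k - N₀ + 1) := by
    calc (L : ℝ) ^ s k ≤ (L : ℝ) ^ s (k - N₀ + 1) := pow_le_pow_right₀ hL1.le hanti
      _ ≤ (L : ℝ) * (L : ℝ) ^ s (k - N₀ + 1) := le_mul_of_one_le_left (by positivity) hL1.le
  have hR' : (L : ℝ) ^ s (k - N₀ + 1) = (L : ℝ) ^ (N₀ - 1) := by rw [hEq]
  exact L0inv_pow_le_rpow hL1 hL₀ hR' (by positivity) hmono

end AlongFlow2

/-- **p. 200**, verbatim: *"The number on the right-hand side is ≦ 1/4 for R_k^{−α₀}, or γ sufficiently small"* — why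
small `γ` makes `R_k^{−α₀}` small: by (2.5) [III] `R_k ≧ (log g_k⁻²)^p ≧ (log γ⁻²)^p > 0` for `0 < g_k ≦ γ < 1` with
`log γ⁻² ≧ 1` (true for `γ ≦ e^{−1/2}`), so `R_k^{−α₀} ≦ ((log γ⁻²)^p)^{−α₀}` (`α₀ ≧ 0`). [cite: Balaban1989LargeFieldI, p.200] -/
theorem rpow_Rk_le_of_isRj {L p : ℕ} {g γ : ℝ} {Rk : ℕ} (h : B14.IsRj L p g Rk) (hg : 0 < g) (hgγ : g ≤ γ)
    (hγ : 1 ≤ Real.log (γ ^ 2)⁻¹) {α₀ : ℝ} (hα₀ : 0 ≤ α₀) :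
    (Rk : ℝ) ^ (-α₀) ≤ ((Real.log (γ ^ 2)⁻¹) ^ p) ^ (-α₀) := by
  obtain ⟨_, _, hle, _⟩ := h
  have hmono : Real.log (γ ^ 2)⁻¹ ≤ Real.log (g ^ 2)⁻¹ := log_inv_sq_mono hg hgγ
  have hpow : (Real.log (γ ^ 2)⁻¹) ^ p ≤ (Real.log (g ^ 2)⁻¹) ^ p :=
    pow_le_pow_left₀ (by linarith) hmono p
  have hpos : 0 < (Real.log (γ ^ 2)⁻¹) ^ p := by positivity
  exact Real.rpow_le_rpow_of_nonpos hpos (hpow.trans hle) (by linarith)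

/-! ## §8. Assembly: «U″_{k,Z} satisfies all the conditions in the definition (1.24), hence χ″_k = 1» -/

/-- **p. 200, the conclusion**, verbatim: *"Thus we have proved that the configuration U″_{k,Z} satisfies all the
conditions in the definition (1.24), hence χ″_k = 1"* — ASSEMBLED over abstract plaquette families of the four kinds of
domains of (1.24) at `n = N` (deviations `dev : ι → ℝ` of `U″_{k,Z}`; `E j = ε_j(L^{k−j}η)²`, so `E k = ε_kη²`;
the last-term coefficient `X j = O(1)(1 + L^{−j}αε_j)²B₃B₅M⁵` of `B15Ineq196Proof.ineq198` and its increase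
`X′ ≧ 2 + X j`):
* on `Ω_m∖Ω_{m+1}` (`k₀ < m < k`; plaquettes `SΩ m`) the (1.98)-bound with `j = k` and the last term made `≦ α`
  (hypothesis `hA`, cf. `lastTerm_le` ∕ `exists_M_lastTerm_lt`) gives the top line (`m = k − 1`, `c = 3`) and the
  `(1 − β½)L₀^{2(k−m−1)}` lines;
* on `Ω^c_{k₀+1}∖Z″_k` (`SOut`) and on `Z″_{j+1}∖Z″_j`, `k₀ < j < k` (`SZ j`), the (1.98)-bound with `dist ≧ 0` and the
  printed smallness `X′L₀^{−2(N₀−1)} ≦ 1/4` give the `(1 − β½)L₀^{2(k−k₀−1)}` line and the `SF149` lines;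
* on `Z″_{j+1}∖Z″_j`, `h < j ≦ k₀`, and on the part of `Z″_{h+1}∩Ω_h` inside `Ω″^∼_{h+1}` the same bound gives the `SF149`
  lines with `L₀`-power `1`; on the part `(Ω″^∼_{h+1})^c∩Ω_h` (`Shalf`) the (1.96)-bound `dev < ¾ε_h(L^{k−h}η)²`
  (`B15Ineq196Proof.ineq196_of_191_195`) gives the `j = h` line (`¾ < 1 − β(1 − t)`, b01 `coeff196`).
Side conditions as printed: `α ≦ 1/8`, `0 ≦ β ≦ 1/4`, `2 ≦ L₀`, `L₀² ≦ L`, `h ≦ k₀ < k` (the top domain `Ω_{k−1}` is one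
of the `Ω_m∖Ω_{m+1}`, `k₀ < m`, only when `N₀ = k − k₀ ≧ 2`). [cite: Balaban1989LargeFieldI, p.200] -/
theorem lines124N_of_bounds {ι : Type*} (dev : ι → ℝ) {h k₀ k : ℕ} (hhk : h ≤ k₀) (hk : k₀ < k)
    {α β L L₀ δ : ℝ} (E X : ℕ → ℝ) (X' : ℝ) (t : ℕ → ℝ) (dist : ι → ℝ)
    (hα : α ≤ 1 / 8) (hβ0 : 0 ≤ β) (hβ : β ≤ 1 / 4) (hL₀ : 2 ≤ L₀) (hL₀L : L₀ ^ 2 ≤ L)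
    (hE : ∀ j, 0 ≤ E j) (hX : ∀ j, 0 ≤ X j) (hX' : ∀ j, 2 + X j ≤ X') (ht : ∀ j, 0 < t j ∧ t j ≤ 1)
    (hdist : ∀ p, 0 ≤ δ * dist p) (hsmall : X' * ((L₀ ^ 2) ^ (k - k₀ - 1))⁻¹ ≤ 1 / 4)
    -- the four kinds of domains of (1.24) at n = N, as plaquette families
    (SΩ : ℕ → Set ι) (SOut : Set ι) (SZ : ℕ → Set ι) (Shalf : Set ι)
    -- the bounds of pp. 199–200 on them
    (hA : ∀ m, k₀ < m → m < k → ∀ p ∈ SΩ m, ∃ T, T ≤ α ∧ dev p < (2 * 1 + 4 * α + T * 1) * E k)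
    (hOut : ∀ p ∈ SOut, dev p < (2 * (L ^ (k - k))⁻¹ + 4 * α
        + X k * Real.exp (-δ * dist p) * (L ^ (k - k))⁻¹) * E k)
    (hZ : ∀ j, h ≤ j → j < k → ∀ p ∈ SZ j, dev p < (2 * (L ^ (k - j))⁻¹ + 4 * α
        + X j * Real.exp (-δ * dist p) * (L ^ (k - j))⁻¹) * E j)
    (hhalf : ∀ p ∈ Shalf, dev p < 3 / 4 * E h) :
    -- all the lines of (1.24) at n = N
    (k₀ + 2 ≤ k → ∀ p ∈ SΩ (k - 1), SF124c (dev p) (cTop k k) β (E k)) ∧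
    (∀ m, k₀ < m → m + 2 ≤ k → ∀ p ∈ SΩ m, SF151 (dev p) β (L₀ ^ (2 * (k - m - 1))) (E k)) ∧
    (∀ p ∈ SOut, SF151 (dev p) β ((L₀ ^ 2) ^ (k - k₀ - 1)) (E k)) ∧
    (∀ j, h ≤ j → j < k → ∀ p ∈ SZ j, SF149 (dev p) β (t j) ((L₀ ^ 2) ^ (j - k₀ - 1)) (E j)) ∧
    (∀ p ∈ Shalf, SF149 (dev p) β (t h) ((L₀ ^ 2) ^ (h - k₀ - 1)) (E h)) := by
  have hL₀1 : 1 ≤ L₀ := by linarith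
  have hX'0 : 0 ≤ X' := by linarith [hX 0, hX' 0]
  refine ⟨?_, ?_, ?_, ?_, ?_⟩
  · -- top line, m = k − 1 (present when k₀ < k − 1, i.e. N₀ ≧ 2)
    intro hk2 p hp
    obtain ⟨T, hT, hb⟩ := hA (k - 1) (by omega) (by omega) p hp
    exact caseA_top k hb hT hα hβ (hE k)
  · -- Ω_m∖Ω_{m+1}, k₀ < m ≦ k − 2
    intro m hm hmk p hp
    obtain ⟨T, hT, hb⟩ := hA m hm (by omega) p hp
    exact caseA_line hb hT hα hβ hL₀ (by omega) (hE k)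
  · -- Ω^c_{k₀+1}∖Z″_k, j = k
    intro p hp
    have hb := hOut p hp
    have hLk : (L ^ (k - k))⁻¹ ≤ ((L₀ ^ 2) ^ 0)⁻¹ := by simp
    have hb' := caseB_bound hb (hdist p) (hX k) (by simp) hLk (hX' k) (hE k)
    exact caseB_outer hb' hα hβ0 hβ hL₀1 hsmall (hE k)
  · -- Z″_{j+1}∖Z″_j, h ≦ j < k
    intro j hj hjk p hp
    have hb := hZ j hj hjk p hp
    have hLj : (L ^ (k - j))⁻¹ ≤ ((L₀ ^ 2) ^ (k - j))⁻¹ := Linv_le_L0inv hL₀1 hL₀L (k - j)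
    have hL0 : 0 ≤ (L ^ (k - j))⁻¹ := by
      have : 0 ≤ L := le_trans (by positivity) hL₀L
      positivity
    have hb' := caseB_bound hb (hdist p) (hX j) hL0 hLj (hX' j) (hE j)
    by_cases hjk₀ : k₀ < j
    · -- k₀ < j < k: a = k − j, b = j − k₀ − 1, a + b = k − k₀ − 1
      have hab : k - j + (j - k₀ - 1) = k - k₀ - 1 := by omega
      exact caseB_shell hb' hα hβ0 hβ hL₀1 (by rw [hab]; exact hsmall) (ht j).1.le (hE j)
    · -- h ≦ j ≦ k₀: k − j ≧ N₀ > N₀ − 1 = k − k₀ − 1, and L₀-power 1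
      have hb0 : j - k₀ - 1 = 0 := by omega
      rw [hb0, pow_zero]
      exact caseC_shell hb' hα hβ0 hβ hL₀1 hX'0 (by omega : k - k₀ - 1 ≤ k - j) hsmall (ht j).1.le (hE j)
  · -- (Ω″^∼_{h+1})^c∩Ω_h: the (1.96) bound
    intro p hp
    have hb := hhalf p hp
    have hb0 : h - k₀ - 1 = 0 := by omega
    rw [hb0, pow_zero]
    unfold SF149
    have hc : 3 / 4 < 1 - β * (1 - t h) := coeff196 hβ (ht h).1 (ht h).2
    have : 3 / 4 * E h ≤ (1 - β * (1 - t h)) * 1 * E h := by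
      rw [mul_one]; exact mul_le_mul_of_nonneg_right hc.le (hE h)
    linarith

/-- **(1.89)**, p. 198∕p. 200: *"we can drop the function χ″_k, i.e., we have the equality (1.89)"* … *"hence χ″_k = 1, and
the equality (1.89) is proved"* — in the implication form of the typed claim (`B15.BasicStep.Claim189 remaining dropped`,
= `Claim129`): if the remaining characteristic functions imply, for the configuration `U″_{k,Z}(U)`, the per-domain bounds
of pp. 199–200 (hypothesis `hchain` — the content of (1.90)–(1.98), whose typed leaves stay hypotheses), and those
bounds imply all the lines of (1.24) at `n = N` (`lines124N_of_bounds`), then `Claim189 remaining dropped` for `dropped`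
:= «all the lines of (1.24) at n = N hold».  Bookkeeping (composition). [cite: Balaban1989LargeFieldI, (1.89) p.198] -/
theorem claim189_of_chain {C : Type*} (remaining bounds dropped : C → Prop)
    (hchain : ∀ U, remaining U → bounds U) (hcases : ∀ U, bounds U → dropped U) :
    Claim189 remaining dropped := by
  intro U hU
  exact hcases U (hchain U hU)

end Literature.MathematicalPhysics.QuantumFieldTheory.Balaban1983to89.B15Claim189Cases
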